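import Summits.Ventures.YMGap.FlowData.PlaquetteCharacterTail
import HarnessLib

/-!
# Venture YMGap, track Y3 FLOW-DATA — the plaquette-tail constants of the lineage-A table as `norm_num` instances

HONEST FRAMING: venture file of the cell `pub-ymgap` (QuantumFields programme), track Y3, lineage A (seat flow-eng-1).  Pure
rational arithmetic on partial power sums of modified Bessel functions; NO lattice statement, no number of record, nothing about
limits or a mass gap.  Each theorem certifies, inside Lean, the sup-norm character-tail constant `τ = τ_N(b)/c₀(b)` that a family
of lineage-A transfer-matrix rows uses (ENGINE.md §3 (ii), task JSON `constants.tau_hi` from `kit_build.exact_constants`), via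
`PlaquetteCharacterTail.tailSum_div_charCoeff_le` with the enclosures `besselI_le_sum_range_add` / `sum_range_besselTerm_le`;
every bound is within 2 ‰ above the engine's interval-arithmetic value.

| theorem | β | characters kept | bound | engine `tau_hi` | rows |
|---|---|---|---|---|---|
| `tau_le_quarter_seven` | 1/4 | 2J ≤ 6 | 7.66e-10 | 7.6573542e-10 | 4×4 ¼ |
| `tau_le_half_seven` | 1/2 | 2J ≤ 6 | 9.8e-8 | 9.7997629e-8 | 4×4 ½, 3×3 ½, 2×3 ½ |
| `tau_le_threeQuarters_seven` | 3/4 | 2J ≤ 6 | 1.66e-6 | 1.6550201e-6 | 4×4 ¾, 2×4 ¾ |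
| `tau_le_one_eight` | 1 | 2J ≤ 7 | 8.43e-7 | 8.4243239e-7 | 3×3 1, 2×3 1 |
| `tau_le_threeHalves_seven` | 3/2 | 2J ≤ 6 | 1.93e-4 | 1.9216e-4 (majorant) | 2×3 3/2 |
| `tau_le_threeHalves_eight` | 3/2 | 2J ≤ 7 | 1.99e-5 | 1.9870e-5 (majorant) | 2×2 3/2 |
| `tau_le_two_ten` | 2 | 2J ≤ 9 | 2.3e-6 | 2.2948066e-6 | 2×3 2 (g7 hub-local) |
| `tau_le_fiveHalves_eight` | 5/2 | 2J ≤ 7 | 9.1e-4 | 9.074e-4 (majorant; τ₁ of TAIL-2) | 2×2 5/2 |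
| `tau_le_three_eight` | 3 | 2J ≤ 7 | 3.3e-3 | 3.2989e-3 (majorant; τ₁ of TAIL-2) | 2×2 3 |
| `tau_le_sevenHalves_eleven` | 7/2 | 2J ≤ 10 | 5.97e-5 | 5.9619027e-5 | 2×2 7/2 (g7 hub-local) |

References: I. Montvay, G. Münster (1994) §3.2.6 [cite: MontvayMunster1994, §3.2.6]; Abramowitz–Stegun 9.6.10
[cite: AbramowitzStegun1964, 9.6.10].
-/

noncomputable section

open Finset
open Literature.Analysis.FunctionSpaces
open Summit.Ventures.YMGap.FlowData.PlaquetteCharacterTail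

namespace Summit.Ventures.YMGap.FlowData.PlaquetteCharacterTailInstances

/-- **Worked instance (the constant of every 4×4 β = 3/4 row of record)**: at `b = 3/4` with the characters kept up to
`2J ≤ 6` (`N = 7`) the engine uses `τ = 1.6550200950e-6` (`kit_build.exact_constants`, task JSON `constants.tau_hi`); the
typed chain gives, by pure rational arithmetic on partial power sums (two or three terms each), `τ_7(3/4)/c₀(3/4) ≤ 1.66e-6`.
[cite: MontvayMunster1994, §3.2.6] -/
theorem tau_le_threeQuarters_seven : tailSum (3 / 4) 7 / charCoeff (3 / 4) 0 ≤ 166 / 100000000 := by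
  refine (tailSum_div_charCoeff_le (b := 3 / 4) (by norm_num) 7 (by norm_num)
    (besselI_le_sum_range_add 7 2 (by norm_num) (by norm_num))
    (besselI_le_sum_range_add 8 2 (by norm_num) (by norm_num))
    (besselI_le_sum_range_add 9 2 (by norm_num) (by norm_num))
    (sum_range_besselTerm_le 1 3 (by norm_num)) ?_).trans ?_
  · norm_num [besselTerm, Finset.sum_range_succ, Finset.sum_range_zero, Nat.factorial]
  · norm_num [besselTerm, Finset.sum_range_succ, Finset.sum_range_zero, Nat.factorial]

/-- Worked instance: `τ_7(1 / 4)/c₀ ≤ 766 / 1000000000000` (engine `tau_hi` = 7.6573542e-10; rows: 4×4 ¼ (2J ≤ 6)). [cite: MontvayMunster1994, §3.2.6] -/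
theorem tau_le_quarter_seven : tailSum (1 / 4) 7 / charCoeff (1 / 4) 0 ≤ 766 / 1000000000000 := by
  refine (tailSum_div_charCoeff_le (b := 1 / 4) (by norm_num) 7 (by norm_num)
    (besselI_le_sum_range_add 7 2 (by norm_num) (by norm_num))
    (besselI_le_sum_range_add 8 2 (by norm_num) (by norm_num))
    (besselI_le_sum_range_add 9 2 (by norm_num) (by norm_num))
    (sum_range_besselTerm_le 1 3 (by norm_num)) ?_).trans ?_
  · norm_num [besselTerm, Finset.sum_range_succ, Finset.sum_range_zero, Nat.factorial]
  · norm_num [besselTerm, Finset.sum_range_succ, Finset.sum_range_zero, Nat.factorial]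

/-- Worked instance: `τ_7(1 / 2)/c₀ ≤ 98 / 1000000000` (engine `tau_hi` = 9.7997629e-8; rows: 4×4 ½ / 3×3 ½ / 2×3 ½ (2J ≤ 6)). [cite: MontvayMunster1994, §3.2.6] -/
theorem tau_le_half_seven : tailSum (1 / 2) 7 / charCoeff (1 / 2) 0 ≤ 98 / 1000000000 := by
  refine (tailSum_div_charCoeff_le (b := 1 / 2) (by norm_num) 7 (by norm_num)
    (besselI_le_sum_range_add 7 2 (by norm_num) (by norm_num))
    (besselI_le_sum_range_add 8 2 (by norm_num) (by norm_num))
    (besselI_le_sum_range_add 9 2 (by norm_num) (by norm_num))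
    (sum_range_besselTerm_le 1 3 (by norm_num)) ?_).trans ?_
  · norm_num [besselTerm, Finset.sum_range_succ, Finset.sum_range_zero, Nat.factorial]
  · norm_num [besselTerm, Finset.sum_range_succ, Finset.sum_range_zero, Nat.factorial]

/-- Worked instance: `τ_8(1)/c₀ ≤ 843 / 1000000000` (engine `tau_hi` = 8.4243239e-7; rows: 3×3 1 / 2×3 1 (2J ≤ 7)). [cite: MontvayMunster1994, §3.2.6] -/
theorem tau_le_one_eight : tailSum (1) 8 / charCoeff (1) 0 ≤ 843 / 1000000000 := by
  refine (tailSum_div_charCoeff_le (b := 1) (by norm_num) 8 (by norm_num)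
    (besselI_le_sum_range_add 8 2 (by norm_num) (by norm_num))
    (besselI_le_sum_range_add 9 2 (by norm_num) (by norm_num))
    (besselI_le_sum_range_add 10 2 (by norm_num) (by norm_num))
    (sum_range_besselTerm_le 1 3 (by norm_num)) ?_).trans ?_
  · norm_num [besselTerm, Finset.sum_range_succ, Finset.sum_range_zero, Nat.factorial]
  · norm_num [besselTerm, Finset.sum_range_succ, Finset.sum_range_zero, Nat.factorial]

/-- Worked instance: `τ_10(2)/c₀ ≤ 23 / 10000000` (engine `tau_hi` = 2.2948066e-6; rows: 2×3 β = 2 (2J ≤ 9, the g7 hub-local point)). [cite: MontvayMunster1994, §3.2.6] -/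
theorem tau_le_two_ten : tailSum (2) 10 / charCoeff (2) 0 ≤ 23 / 10000000 := by
  refine (tailSum_div_charCoeff_le (b := 2) (by norm_num) 10 (by norm_num)
    (besselI_le_sum_range_add 10 3 (by norm_num) (by norm_num))
    (besselI_le_sum_range_add 11 3 (by norm_num) (by norm_num))
    (besselI_le_sum_range_add 12 3 (by norm_num) (by norm_num))
    (sum_range_besselTerm_le 1 4 (by norm_num)) ?_).trans ?_
  · norm_num [besselTerm, Finset.sum_range_succ, Finset.sum_range_zero, Nat.factorial]
  · norm_num [besselTerm, Finset.sum_range_succ, Finset.sum_range_zero, Nat.factorial]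

/-- Worked instance: `τ_11(7 / 2)/c₀ ≤ 597 / 10000000` (engine `tau_hi` = 5.9619027e-5; rows: 2×2 β = 7/2 (2J ≤ 10, the g7 hub-local point)). [cite: MontvayMunster1994, §3.2.6] -/
theorem tau_le_sevenHalves_eleven : tailSum (7 / 2) 11 / charCoeff (7 / 2) 0 ≤ 597 / 10000000 := by
  refine (tailSum_div_charCoeff_le (b := 7 / 2) (by norm_num) 11 (by norm_num)
    (besselI_le_sum_range_add 11 4 (by norm_num) (by norm_num))
    (besselI_le_sum_range_add 12 4 (by norm_num) (by norm_num))
    (besselI_le_sum_range_add 13 4 (by norm_num) (by norm_num))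
    (sum_range_besselTerm_le 1 6 (by norm_num)) ?_).trans ?_
  · norm_num [besselTerm, Finset.sum_range_succ, Finset.sum_range_zero, Nat.factorial]
  · norm_num [besselTerm, Finset.sum_range_succ, Finset.sum_range_zero, Nat.factorial]

/-- Worked instance: β = 3/2, 2J ≤ 6 (2×3 3/2 rows): ≤ 1.93e-4 (majorant 1.9216e-4). [cite: MontvayMunster1994, §3.2.6] -/
theorem tau_le_threeHalves_seven : tailSum (3 / 2) 7 / charCoeff (3 / 2) 0 ≤ 193 / 1000000 := by
  refine (tailSum_div_charCoeff_le (b := 3 / 2) (by norm_num) 7 (by norm_num)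
    (besselI_le_sum_range_add 7 3 (by norm_num) (by norm_num))
    (besselI_le_sum_range_add 8 3 (by norm_num) (by norm_num))
    (besselI_le_sum_range_add 9 3 (by norm_num) (by norm_num))
    (sum_range_besselTerm_le 1 4 (by norm_num)) ?_).trans ?_
  · norm_num [besselTerm, Finset.sum_range_succ, Finset.sum_range_zero, Nat.factorial]
  · norm_num [besselTerm, Finset.sum_range_succ, Finset.sum_range_zero, Nat.factorial]

/-- Worked instance: β = 3/2, 2J ≤ 7 (2×2 3/2 rows): ≤ 1.99e-5 (majorant 1.9870e-5). [cite: MontvayMunster1994, §3.2.6] -/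
theorem tau_le_threeHalves_eight : tailSum (3 / 2) 8 / charCoeff (3 / 2) 0 ≤ 199 / 10000000 := by
  refine (tailSum_div_charCoeff_le (b := 3 / 2) (by norm_num) 8 (by norm_num)
    (besselI_le_sum_range_add 8 3 (by norm_num) (by norm_num))
    (besselI_le_sum_range_add 9 3 (by norm_num) (by norm_num))
    (besselI_le_sum_range_add 10 3 (by norm_num) (by norm_num))
    (sum_range_besselTerm_le 1 4 (by norm_num)) ?_).trans ?_
  · norm_num [besselTerm, Finset.sum_range_succ, Finset.sum_range_zero, Nat.factorial]
  · norm_num [besselTerm, Finset.sum_range_succ, Finset.sum_range_zero, Nat.factorial]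

/-- Worked instance: β = 5/2, 2J ≤ 7 = τ₁ of the TAIL-2 rows at 2×2 5/2: ≤ 9.1e-4 (majorant 9.074e-4). [cite: MontvayMunster1994, §3.2.6] -/
theorem tau_le_fiveHalves_eight : tailSum (5 / 2) 8 / charCoeff (5 / 2) 0 ≤ 91 / 100000 := by
  refine (tailSum_div_charCoeff_le (b := 5 / 2) (by norm_num) 8 (by norm_num)
    (besselI_le_sum_range_add 8 3 (by norm_num) (by norm_num))
    (besselI_le_sum_range_add 9 3 (by norm_num) (by norm_num))
    (besselI_le_sum_range_add 10 3 (by norm_num) (by norm_num))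
    (sum_range_besselTerm_le 1 5 (by norm_num)) ?_).trans ?_
  · norm_num [besselTerm, Finset.sum_range_succ, Finset.sum_range_zero, Nat.factorial]
  · norm_num [besselTerm, Finset.sum_range_succ, Finset.sum_range_zero, Nat.factorial]

/-- Worked instance: β = 3, 2J ≤ 7 = τ₁ of the TAIL-2 rows at 2×2 3: ≤ 3.3e-3 (majorant 3.2989e-3). [cite: MontvayMunster1994, §3.2.6] -/
theorem tau_le_three_eight : tailSum (3) 8 / charCoeff (3) 0 ≤ 33 / 10000 := by
  refine (tailSum_div_charCoeff_le (b := 3) (by norm_num) 8 (by norm_num)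
    (besselI_le_sum_range_add 8 4 (by norm_num) (by norm_num))
    (besselI_le_sum_range_add 9 4 (by norm_num) (by norm_num))
    (besselI_le_sum_range_add 10 4 (by norm_num) (by norm_num))
    (sum_range_besselTerm_le 1 5 (by norm_num)) ?_).trans ?_
  · norm_num [besselTerm, Finset.sum_range_succ, Finset.sum_range_zero, Nat.factorial]
  · norm_num [besselTerm, Finset.sum_range_succ, Finset.sum_range_zero, Nat.factorial]

end Summit.Ventures.YMGap.FlowData.PlaquetteCharacterTailInstances

end
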